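import Mathlib.AlgebraicGeometry.Modules.Sheaf
import Mathlib.Algebra.Category.ModuleCat.Stalk
import Mathlib.Topology.Sheaves.SheafCondition.UniqueGluing
import HarnessLib

/-!
# Stalks of `𝒪_X`-modules as `𝒪_{X,x}`-modules, skyscraper `𝒪_X`-modules, and `stalk ⊣ skyscraper`

For a scheme `X`, a point `x : X` and the category `X.Modules` of `𝒪_X`-modules (Mathlib):

* `stalkFunctor x : X.Modules ⥤ ModuleCat 𝒪_{X,x}` — the stalk `M_x` with its `𝒪_{X,x}`-module
  structure (Mathlib `ModuleCat/Stalk`: `PresheafOfModules.germ_smul`), functorial in `M`;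
* `skyscraper x A : X.Modules` — for an `𝒪_{X,x}`-module `A`, the skyscraper `𝒪_X`-module `i_{x,*}A`
  at `x`: its sections over `U` are the functions `PLift (x ∈ U) → A` (so `A` if `x ∈ U` and `0`
  otherwise — no case distinction is needed), `Γ(U, 𝒪_X)` acting through the germ maps
  `Γ(U, 𝒪_X) → 𝒪_{X,x}`; `skyscraperFunctor x : ModuleCat 𝒪_{X,x} ⥤ X.Modules`;
* `stalkSkyscraperAdjunction x : stalkFunctor x ⊣ skyscraperFunctor x` —
  **`Hom_{𝒪_{X,x}}(M_x, A) ≃ Hom_{𝒪_X}(M, i_{x,*}A)`** (`stalkSkyscraperHomEquiv`).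

This is the `𝒪_X`-module version of Mathlib's `skyscraperPresheafStalkAdjunction` (abelian sheaves):
Görtz–Wedhorn, *Algebraic Geometry I* (2nd ed.), §(7.8) (direct image of modules along a morphism of
ringed spaces — here the inclusion `i_x : ({x}, 𝒪_{X,x}) → (X, 𝒪_X)`, whose direct image is the skyscraper
of Exercise 2.14) and Prop. 7.11 (the adjunction `Hom_{𝒪_X}(i_x^*𝓕, A) ≅ Hom(𝓕, i_{x,*}A)`, with
`i_x^*𝓕 = 𝓕_x` by (7.8.6)); Hartshorne II Ex. 1.17 (skyscraper sheaves) with II §5. Everything is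
proved; no named facts.

Written for the cell `pub-hodge-ring2` (route №4, crux stmt-HodgeConjecture-26512, node
«IsogenyDerivedAdjointPair», block (Q1c) on ALL `𝒪`-modules: the stalk formula
`(f^*N)_x ≅ 𝒪_{X,x} ⊗ N_{f x}` by uniqueness of adjoints and «flat pull-back preserves monomorphisms»,
file `Modules/PullbackStalk`).

## References

* U. Görtz, T. Wedhorn, *Algebraic Geometry I: Schemes*, 2nd ed. (2020), §(7.8) (direct and inverse
  image of `𝒪_X`-modules, (7.8.6) stalks), Prop. 7.11 (`f^* ⊣ f_*`), Exercise 2.14 (skyscraper sheaves)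
  — read in the held copy `book:gortz2020-algebraic-geometry-i-schemes-2nd-ed` (text chunks p0084,
  p0221–p0223). [GortzWedhorn2020]
* R. Hartshorne, *Algebraic Geometry* (1977), II Ex. 1.17 (skyscraper sheaves), II §5. [Hartshorne1977]
-/

noncomputable section

-- `TopCat.Presheaf`/`Scheme.Modules` are not reducible (as in Mathlib's `AlgebraicGeometry/Modules`).
set_option backward.isDefEq.respectTransparency false

open CategoryTheory CategoryTheory.Limits AlgebraicGeometry TopologicalSpace Opposite

universe u

namespace Literature.AlgebraicGeometry.Modules

variable {X : Scheme.{u}} (x : X)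

/-! ### The `𝒪_{X,x}`-module structure on the stalk `M_x` -/

/-- The underlying presheaf of modules of `M : X.Modules`, typed over `X.presheaf ⋙ forget₂` (the form
in which Mathlib's `ModuleCat/Stalk` endows stalks with their module structure). [folklore] -/
abbrev valC (M : X.Modules) : PresheafOfModules.{u} (X.presheaf ⋙ forget₂ CommRingCat RingCat) := M.val

/-- The `𝒪_{X,x}`-module structure on the (abelian) stalk `M_x` (Mathlib `ModuleCat/Stalk`). [folklore] -/
instance stalkModule (M : X.Modules) : Module (X.presheaf.stalk x) ↑(M.presheaf.stalk x) :=
  inferInstanceAs (Module (X.presheaf.stalk x) ↑(TopCat.Presheaf.stalk (valC M).presheaf x))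

/-- `germ (r • m) = germ r • germ m`. [cite: GortzWedhorn2020, (7.8.6) with (7.4.7)] -/
theorem germ_smul (M : X.Modules) (U : X.Opens) (hx : x ∈ U) (r : Γ(X, U)) (m : Γ(M, U)) :
    M.presheaf.germ U x hx (r • m) = X.presheaf.germ U x hx r • M.presheaf.germ U x hx m :=
  PresheafOfModules.germ_smul (valC M) x U hx r m

/-- Naturality of `φ.app` with respect to restriction, on an element. [folklore] -/
private theorem app_presheaf_map_apply {M N : X.Modules} (φ : M ⟶ N) {U V : X.Opens} (i : V ⟶ U)
    (s : Γ(M, U)) : φ.app V (M.presheaf.map i.op s) = N.presheaf.map i.op (φ.app U s) := by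
  have h := ConcreteCategory.congr_hom (φ.mapPresheaf.naturality i.op) s
  rw [ConcreteCategory.comp_apply, ConcreteCategory.comp_apply] at h
  exact h

/-- The stalk map `M_x → N_x` of a morphism of `𝒪_X`-modules, as a function. [folklore] -/
def stalkMapFun {M N : X.Modules} (φ : M ⟶ N) : ↑(M.presheaf.stalk x) → ↑(N.presheaf.stalk x) :=
  fun v => (TopCat.Presheaf.stalkFunctor Ab x).map φ.mapPresheaf v

/-- The stalk map on a germ. [cite: GortzWedhorn2020, (7.8.6)] -/
theorem stalkMapFun_germ {M N : X.Modules} (φ : M ⟶ N) (U : X.Opens) (hx : x ∈ U) (m : Γ(M, U)) :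
    stalkMapFun x φ (M.presheaf.germ U x hx m) = N.presheaf.germ U x hx (φ.app U m) :=
  TopCat.Presheaf.stalkFunctor_map_germ_apply U x hx φ.mapPresheaf m

/-- The stalk map of a morphism of `𝒪_X`-modules is `𝒪_{X,x}`-linear. [cite: GortzWedhorn2020, (7.8.6)] -/
theorem stalkMapFun_smul {M N : X.Modules} (φ : M ⟶ N) (r : X.presheaf.stalk x)
    (v : ↑(M.presheaf.stalk x)) :
    stalkMapFun x φ (r • v) = r • stalkMapFun x φ v := by
  obtain ⟨U, hxU, s, rfl⟩ := X.presheaf.exists_germ_eq r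
  obtain ⟨V, hxV, m, rfl⟩ := M.presheaf.exists_germ_eq v
  -- move both to `U ⊓ V`
  rw [← X.presheaf.germ_res_apply (homOfLE inf_le_left : U ⊓ V ⟶ U) x ⟨hxU, hxV⟩,
    ← M.presheaf.germ_res_apply (homOfLE inf_le_right : U ⊓ V ⟶ V) x ⟨hxU, hxV⟩,
    ← germ_smul, stalkMapFun_germ, stalkMapFun_germ, Scheme.Modules.Hom.app_smul, germ_smul]

/-- **The stalk functor `M ↦ M_x` from `𝒪_X`-modules to `𝒪_{X,x}`-modules.**
[cite: GortzWedhorn2020, (7.8.6)] -/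
def stalkFunctor : X.Modules ⥤ ModuleCat.{u} (X.presheaf.stalk x) where
  obj M := ModuleCat.of _ ↑(M.presheaf.stalk x)
  map {M N} φ := ModuleCat.ofHom
    { toFun := stalkMapFun x φ
      map_add' := fun v w => ((TopCat.Presheaf.stalkFunctor Ab x).map φ.mapPresheaf).hom.map_add v w
      map_smul' := fun r v => stalkMapFun_smul x φ r v }
  map_id M := by
    ext v
    change stalkMapFun x (𝟙 M) v = v
    unfold stalkMapFun
    have h1 : Scheme.Modules.Hom.mapPresheaf (𝟙 M) = 𝟙 M.presheaf := (Scheme.Modules.toPresheaf X).map_id M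
    rw [h1, CategoryTheory.Functor.map_id]
    rfl
  map_comp {M N P} φ ψ := by
    ext v
    change stalkMapFun x (φ ≫ ψ) v = stalkMapFun x ψ (stalkMapFun x φ v)
    unfold stalkMapFun
    have h1 : Scheme.Modules.Hom.mapPresheaf (φ ≫ ψ) = φ.mapPresheaf ≫ ψ.mapPresheaf :=
      (Scheme.Modules.toPresheaf X).map_comp φ ψ
    rw [h1, CategoryTheory.Functor.map_comp]
    rfl

/-- The germ of a section, as an element of `(stalkFunctor x).obj M`. [folklore] -/
abbrev stalkGerm (M : X.Modules) (U : X.Opens) (hx : x ∈ U) (s : Γ(M, U)) : (stalkFunctor x).obj M :=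
  M.presheaf.germ U x hx s

/-- Every element of the stalk is a germ. [cite: GortzWedhorn2020, (7.8.6)] -/
theorem exists_stalkGerm_eq (M : X.Modules) (v : (stalkFunctor x).obj M) :
    ∃ (U : X.Opens) (hx : x ∈ U) (s : Γ(M, U)), stalkGerm x M U hx s = v :=
  M.presheaf.exists_germ_eq v

/-- The stalk functor on a germ. [cite: GortzWedhorn2020, (7.8.6)] -/
theorem stalkFunctor_map_germ {M N : X.Modules} (φ : M ⟶ N) (U : X.Opens) (hx : x ∈ U) (m : Γ(M, U)) :
    (stalkFunctor x).map φ (stalkGerm x M U hx m) = stalkGerm x N U hx (φ.app U m) :=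
  stalkMapFun_germ x φ U hx m

/-! ### The skyscraper `𝒪_X`-module `i_{x,*}A` -/

section Skyscraper

variable (A : ModuleCat.{u} (X.presheaf.stalk x))

/-- Sections of the skyscraper module over `U`: functions `PLift (x ∈ U) → A` (`= A` if `x ∈ U`, `= 0` if not).
[cite: GortzWedhorn2020, (7.8) with Exercise 2.14] -/
abbrev SkySections (U : X.Opens) : Type u := PLift (x ∈ U) → A

/-- `Γ(U, 𝒪_X)` acts on `PLift (x ∈ U) → A` through the germ maps `Γ(U, 𝒪_X) → 𝒪_{X,x}`. [folklore] -/
instance skyModule (U : X.Opens) : Module Γ(X, U) (SkySections x A U) where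
  smul r f := fun p => X.presheaf.germ U x p.down r • f p
  one_smul f := funext fun p => by
    change X.presheaf.germ U x p.down (1 : Γ(X, U)) • f p = f p
    rw [map_one, one_smul]
  mul_smul r s f := funext fun p => by
    change X.presheaf.germ U x p.down (r * s) • f p =
      X.presheaf.germ U x p.down r • (X.presheaf.germ U x p.down s • f p)
    rw [map_mul, mul_smul]
  smul_zero r := funext fun p => by
    change X.presheaf.germ U x p.down r • (0 : A) = 0
    rw [smul_zero]
  smul_add r f g := funext fun p => by
    change X.presheaf.germ U x p.down r • (f p + g p) =
      X.presheaf.germ U x p.down r • f p + X.presheaf.germ U x p.down r • g p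
    rw [smul_add]
  add_smul r s f := funext fun p => by
    change X.presheaf.germ U x p.down (r + s) • f p =
      X.presheaf.germ U x p.down r • f p + X.presheaf.germ U x p.down s • f p
    rw [map_add, add_smul]
  zero_smul f := funext fun p => by
    change X.presheaf.germ U x p.down (0 : Γ(X, U)) • f p = 0
    rw [map_zero, zero_smul]

/-- `(r • f) p = germ r • f p`. [cite: GortzWedhorn2020, (7.8) with Exercise 2.14] -/
theorem sky_smul_apply (U : X.Opens) (r : Γ(X, U)) (f : SkySections x A U) (p : PLift (x ∈ U)) :
    (r • f) p = X.presheaf.germ U x p.down r • f p :=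
  rfl

/-- The underlying abelian presheaf of the skyscraper module: `U ↦ (PLift (x ∈ U) → A)`, restriction by
precomposition. [cite: GortzWedhorn2020, (7.8) with Exercise 2.14] -/
def skyPresheaf : TopCat.Presheaf Ab X.toTopCat where
  obj U := AddCommGrpCat.of (SkySections x A U.unop)
  map {U V} i := AddCommGrpCat.ofHom
    { toFun := fun f p => f ⟨i.unop.le p.down⟩
      map_zero' := rfl
      map_add' := fun _ _ => rfl }

/-- Restriction of the skyscraper presheaf, on elements. [cite: GortzWedhorn2020, (7.8) with Exercise 2.14] -/
theorem skyPresheaf_map_apply {U V : (X.Opens)ᵒᵖ} (i : U ⟶ V) (f : SkySections x A U.unop)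
    (p : PLift (x ∈ V.unop)) :
    ((skyPresheaf x A).map i f : SkySections x A V.unop) p = f ⟨i.unop.le p.down⟩ :=
  rfl

/-- The `Γ(U, 𝒪_X)`-module structure on the sections of the skyscraper presheaf, in the form Mathlib's
`PresheafOfModules.ofPresheaf` expects. [folklore] -/
instance skyPresheafModule (U : (X.Opens)ᵒᵖ) :
    Module ((X.presheaf ⋙ forget₂ CommRingCat RingCat).obj U) ((skyPresheaf x A).obj U) :=
  inferInstanceAs (Module Γ(X, U.unop) (SkySections x A U.unop))

/-- The restriction maps are semilinear over the restriction of functions (`germ_res`). [cite: GortzWedhorn2020, (7.8) with Exercise 2.14] -/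
theorem skyPresheaf_map_smul {U V : (X.Opens)ᵒᵖ} (i : U ⟶ V)
    (r : (X.presheaf ⋙ forget₂ CommRingCat RingCat).obj U) (f : (skyPresheaf x A).obj U) :
    (skyPresheaf x A).map i (r • f) =
      (X.presheaf ⋙ forget₂ CommRingCat RingCat).map i r • (skyPresheaf x A).map i f := by
  funext p
  change X.presheaf.germ U.unop x (i.unop.le p.down) r • (f : SkySections x A U.unop) ⟨i.unop.le p.down⟩ =
    X.presheaf.germ V.unop x p.down (X.presheaf.map i r) • (f : SkySections x A U.unop) ⟨i.unop.le p.down⟩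
  rw [show X.presheaf.map i r = X.presheaf.map i.unop.op r from rfl, TopCat.Presheaf.germ_res_apply]

/-- The skyscraper presheaf of modules at `x` with value `A`. [cite: GortzWedhorn2020, (7.8) with Exercise 2.14] -/
def skyPresheafOfModules : PresheafOfModules.{u} (X.presheaf ⋙ forget₂ CommRingCat RingCat) :=
  PresheafOfModules.ofPresheaf (skyPresheaf x A) (fun _ _ i r f => skyPresheaf_map_smul x A i r f)

/-- The skyscraper presheaf `U ↦ (PLift (x ∈ U) → A)` is a sheaf. [cite: GortzWedhorn2020, (7.8) with Exercise 2.14] -/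
theorem skyPresheaf_isSheaf : (skyPresheaf x A).IsSheaf := by
  rw [TopCat.Presheaf.isSheaf_iff_isSheafUniqueGluing]
  intro ι U sf hsf
  have key : ∀ (h : x ∈ iSup U), ∃ i, x ∈ U i := fun h => Opens.mem_iSup.mp h
  refine ⟨fun p => sf (key p.down).choose ⟨(key p.down).choose_spec⟩, ?_, ?_⟩
  · intro i
    funext p
    change sf (key ((Opens.leSupr U i).le p.down)).choose ⟨(key ((Opens.leSupr U i).le p.down)).choose_spec⟩ = sf i p
    have hc := congrFun (hsf (key ((Opens.leSupr U i).le p.down)).choose i)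
      ⟨⟨(key ((Opens.leSupr U i).le p.down)).choose_spec, p.down⟩⟩
    exact hc
  · intro s hs
    funext p
    exact congrFun (hs (key p.down).choose) ⟨(key p.down).choose_spec⟩

/-- **The skyscraper `𝒪_X`-module `i_{x,*}A`** at `x` with value the `𝒪_{X,x}`-module `A`.
[cite: GortzWedhorn2020, (7.8) with Exercise 2.14] [cite: Hartshorne1977, II Ex. 1.17] -/
def skyscraper : X.Modules where
  val := skyPresheafOfModules x A
  isSheaf := skyPresheaf_isSheaf x A

/-- Sections of the skyscraper module over `U` are the functions `PLift (x ∈ U) → A`. [cite: GortzWedhorn2020, (7.8) with Exercise 2.14] -/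
theorem skyscraper_sections (U : X.Opens) : (Γ(skyscraper x A, U) : Type u) = SkySections x A U := rfl

variable {A} {B : ModuleCat.{u} (X.presheaf.stalk x)}

/-- Functoriality of the skyscraper in the `𝒪_{X,x}`-module: postcomposition. [folklore] -/
def skyscraperMap (a : A ⟶ B) : skyscraper x A ⟶ skyscraper x B :=
  ⟨PresheafOfModules.homMk
    { app := fun U => AddCommGrpCat.ofHom
        { toFun := fun (f : SkySections x A U.unop) => fun p => a (f p)
          map_zero' := funext fun _ => map_zero _
          map_add' := fun _ _ => funext fun _ => map_add _ _ _ }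
      naturality := fun _ _ _ => rfl }
    (fun U r f => funext fun p => by
      change a (X.presheaf.germ U.unop x p.down r • (f : SkySections x A U.unop) p) =
        X.presheaf.germ U.unop x p.down r • a ((f : SkySections x A U.unop) p)
      rw [map_smul])⟩

/-- `skyscraperMap` on sections. [cite: GortzWedhorn2020, (7.8) with Exercise 2.14] -/
theorem skyscraperMap_app_apply (a : A ⟶ B) (U : X.Opens) (f : Γ(skyscraper x A, U)) (p : PLift (x ∈ U)) :
    ((skyscraperMap x a).app U f : SkySections x B U) p = a ((f : SkySections x A U) p) :=
  rfl

end Skyscraper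

/-- **The skyscraper functor `A ↦ i_{x,*}A`** from `𝒪_{X,x}`-modules to `𝒪_X`-modules.
[cite: GortzWedhorn2020, (7.8) with Exercise 2.14] -/
def skyscraperFunctor : ModuleCat.{u} (X.presheaf.stalk x) ⥤ X.Modules where
  obj A := skyscraper x A
  map a := skyscraperMap x a
  map_id A := by
    refine Scheme.Modules.hom_ext _ _ fun U => ?_
    ext f
    rfl
  map_comp a b := by
    refine Scheme.Modules.hom_ext _ _ fun U => ?_
    ext f
    rfl

/-! ### The adjunction `stalk ⊣ skyscraper` -/

section Adjunction

variable {x} {M : X.Modules} {A : ModuleCat.{u} (X.presheaf.stalk x)}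

/-- From `ψ : M_x → A`: the morphism `M → i_{x,*}A`, `s ↦ (h ↦ ψ(germ_h s))`. [cite: GortzWedhorn2020, (7.8) with Exercise 2.14] -/
def homToSkyscraper (ψ : (stalkFunctor x).obj M ⟶ A) : M ⟶ skyscraper x A :=
  ⟨PresheafOfModules.homMk
    { app := fun U => AddCommGrpCat.ofHom
        { toFun := fun (s : Γ(M, U.unop)) => fun (p : PLift (x ∈ U.unop)) =>
            ψ (stalkGerm x M U.unop p.down s)
          map_zero' := funext fun p => by
            change ψ (M.presheaf.germ U.unop x p.down 0) = 0
            rw [map_zero, map_zero]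
          map_add' := fun s t => funext fun p => by
            change ψ (M.presheaf.germ U.unop x p.down (s + t)) =
              ψ (M.presheaf.germ U.unop x p.down s) + ψ (M.presheaf.germ U.unop x p.down t)
            rw [map_add, map_add] }
      naturality := fun U V i => by
        ext s
        funext p
        change ψ (M.presheaf.germ V.unop x p.down (M.presheaf.map i s)) =
          ψ (M.presheaf.germ U.unop x (i.unop.le p.down) s)
        rw [show M.presheaf.map i s = M.presheaf.map i.unop.op s from rfl, TopCat.Presheaf.germ_res_apply] }
    (fun U r s => funext fun p => by
      change ψ (M.presheaf.germ U.unop x p.down (r • s)) =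
        X.presheaf.germ U.unop x p.down r • ψ (M.presheaf.germ U.unop x p.down s)
      rw [germ_smul]
      exact ψ.hom.map_smul _ _)⟩

/-- `homToSkyscraper ψ` on sections. [cite: GortzWedhorn2020, Prop. 7.11 (for `i_x`)] -/
theorem homToSkyscraper_app_apply (ψ : (stalkFunctor x).obj M ⟶ A) (U : X.Opens) (s : Γ(M, U))
    (p : PLift (x ∈ U)) :
    ((homToSkyscraper ψ).app U s : SkySections x A U) p = ψ (stalkGerm x M U p.down s) :=
  rfl

/-- The cocone over the neighbourhood system of `x` defined by `φ : M → i_{x,*}A`: `s ∈ Γ(U, M) ↦ φ(s)(x ∈ U)`.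
[folklore] -/
def skyCocone (φ : M ⟶ skyscraper x A) : Cocone ((OpenNhds.inclusion x).op ⋙ M.presheaf) where
  pt := AddCommGrpCat.of A
  ι :=
    { app := fun U => AddCommGrpCat.ofHom
        { toFun := fun s => (φ.app U.unop.1 s : SkySections x A U.unop.1) ⟨U.unop.2⟩
          map_zero' := by rw [map_zero]; rfl
          map_add' := fun s t => by rw [map_add]; rfl }
      naturality := fun U V i => by
        ext s
        change (φ.app V.unop.1 (M.presheaf.map ((OpenNhds.inclusion x).map i.unop).op s) :
            SkySections x A V.unop.1) ⟨V.unop.2⟩ =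
          (φ.app U.unop.1 s : SkySections x A U.unop.1) ⟨U.unop.2⟩
        exact (congrArg (fun g : SkySections x A V.unop.1 => g ⟨V.unop.2⟩)
          (app_presheaf_map_apply φ ((OpenNhds.inclusion x).map i.unop) s)).trans rfl }

/-- From `φ : M → i_{x,*}A`: the map `M_x → A`, `germ_h s ↦ φ(s)(h)`, as a function (the universal
property of the stalk as a colimit). [folklore] -/
def homFromStalkFun (φ : M ⟶ skyscraper x A) : ↑(M.presheaf.stalk x) → A :=
  fun v => colimit.desc ((OpenNhds.inclusion x).op ⋙ M.presheaf) (skyCocone φ) v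

/-- `homFromStalkFun φ` on a germ. [cite: GortzWedhorn2020, Prop. 7.11 (for `i_x`)] -/
theorem homFromStalkFun_germ (φ : M ⟶ skyscraper x A) (U : X.Opens) (h : x ∈ U) (s : Γ(M, U)) :
    homFromStalkFun φ (M.presheaf.germ U x h s) = (φ.app U s : SkySections x A U) ⟨h⟩ := by
  change colimit.desc _ (skyCocone φ) (colimit.ι ((OpenNhds.inclusion x).op ⋙ M.presheaf) (op ⟨U, h⟩) s) = _
  rw [colimit.ι_desc_apply]
  rfl

/-- `homFromStalkFun φ` is `𝒪_{X,x}`-linear. [cite: GortzWedhorn2020, Prop. 7.11 (for `i_x`)] -/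
theorem homFromStalkFun_smul (φ : M ⟶ skyscraper x A) (r : X.presheaf.stalk x) (v : ↑(M.presheaf.stalk x)) :
    homFromStalkFun φ (r • v) = r • homFromStalkFun φ v := by
  obtain ⟨U, hxU, s, rfl⟩ := X.presheaf.exists_germ_eq r
  obtain ⟨V, hxV, m, rfl⟩ := M.presheaf.exists_germ_eq v
  rw [← X.presheaf.germ_res_apply (homOfLE inf_le_left : U ⊓ V ⟶ U) x ⟨hxU, hxV⟩,
    ← M.presheaf.germ_res_apply (homOfLE inf_le_right : U ⊓ V ⟶ V) x ⟨hxU, hxV⟩, ← germ_smul,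
    homFromStalkFun_germ, homFromStalkFun_germ, Scheme.Modules.Hom.app_smul]
  rfl

/-- From `φ : M → i_{x,*}A`: the `𝒪_{X,x}`-linear map `M_x → A`, `germ_h s ↦ φ(s)(h)`.
[cite: GortzWedhorn2020, (7.8) with Exercise 2.14] -/
def homFromStalk (φ : M ⟶ skyscraper x A) : (stalkFunctor x).obj M ⟶ A :=
  ModuleCat.ofHom
    { toFun := homFromStalkFun φ
      map_add' := fun v w =>
        (colimit.desc ((OpenNhds.inclusion x).op ⋙ M.presheaf) (skyCocone φ)).hom.map_add v w
      map_smul' := fun r v => homFromStalkFun_smul φ r v }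

/-- `homFromStalk φ` on a germ. [cite: GortzWedhorn2020, Prop. 7.11 (for `i_x`)] -/
theorem homFromStalk_germ (φ : M ⟶ skyscraper x A) (U : X.Opens) (h : x ∈ U) (s : Γ(M, U)) :
    homFromStalk φ (stalkGerm x M U h s) = (φ.app U s : SkySections x A U) ⟨h⟩ :=
  homFromStalkFun_germ φ U h s

variable (x M A) in
/-- **`Hom_{𝒪_{X,x}}(M_x, A) ≃ Hom_{𝒪_X}(M, i_{x,*}A)`.** [cite: GortzWedhorn2020, Prop. 7.11 (for `i_x`)]
[cite: Hartshorne1977, II Ex. 1.17] -/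
def stalkSkyscraperHomEquiv : ((stalkFunctor x).obj M ⟶ A) ≃ (M ⟶ (skyscraperFunctor x).obj A) where
  toFun ψ := homToSkyscraper ψ
  invFun φ := homFromStalk φ
  left_inv ψ := by
    ext v
    obtain ⟨U, hxU, s, rfl⟩ := exists_stalkGerm_eq x M v
    change homFromStalk (homToSkyscraper ψ) (stalkGerm x M U hxU s) = ψ _
    rw [homFromStalk_germ]
    rfl
  right_inv φ := by
    refine Scheme.Modules.hom_ext _ _ fun U => ?_
    ext s
    change ((homToSkyscraper (homFromStalk φ)).app U s : SkySections x A U) = (φ.app U s : SkySections x A U)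
    funext p
    change homFromStalk φ (stalkGerm x M U p.down s) = _
    rw [homFromStalk_germ]
    rfl

variable (x) in
/-- **The adjunction `stalk ⊣ skyscraper`: `stalkFunctor x ⊣ skyscraperFunctor x`.**
[cite: GortzWedhorn2020, Prop. 7.11 (for `i_x`)] [cite: Hartshorne1977, II Ex. 1.17] -/
def stalkSkyscraperAdjunction : stalkFunctor (X := X) x ⊣ skyscraperFunctor x :=
  Adjunction.mkOfHomEquiv
    { homEquiv := fun M A => stalkSkyscraperHomEquiv x M A
      homEquiv_naturality_left_symm := fun {M N A} φ ψ => by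
        ext v
        obtain ⟨U, hxU, s, rfl⟩ := exists_stalkGerm_eq x M v
        change homFromStalk (φ ≫ ψ) (stalkGerm x M U hxU s) =
          homFromStalk ψ ((stalkFunctor x).map φ (stalkGerm x M U hxU s))
        rw [homFromStalk_germ, stalkFunctor_map_germ, homFromStalk_germ]
        rfl
      homEquiv_naturality_right := fun {M A B} ψ a => by
        refine Scheme.Modules.hom_ext _ _ fun U => ?_
        ext s
        change ((homToSkyscraper (ψ ≫ a)).app U s : SkySections x B U) =
          ((homToSkyscraper ψ ≫ skyscraperMap x a).app U s : SkySections x B U)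
        funext p
        rfl }

/-- The unit of `stalk ⊣ skyscraper` on sections: `s ↦ (h ↦ germ_h s)`. [cite: GortzWedhorn2020, Prop. 7.11 (for `i_x`)] -/
theorem stalkSkyscraperAdjunction_homEquiv_apply (ψ : (stalkFunctor x).obj M ⟶ A) :
    (stalkSkyscraperAdjunction x).homEquiv M A ψ = homToSkyscraper ψ :=
  rfl

/-- The inverse hom-equivalence of `stalk ⊣ skyscraper`: `φ ↦ (germ_h s ↦ φ(s)(h))`. [cite: GortzWedhorn2020, Prop. 7.11 (for `i_x`)] -/
theorem stalkSkyscraperAdjunction_homEquiv_symm_apply (φ : M ⟶ skyscraper x A) :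
    ((stalkSkyscraperAdjunction x).homEquiv M A).symm φ = homFromStalk φ := by
  rw [Equiv.symm_apply_eq, stalkSkyscraperAdjunction_homEquiv_apply]
  exact ((stalkSkyscraperHomEquiv x M A).apply_symm_apply φ).symm

end Adjunction

end Literature.AlgebraicGeometry.Modules

end
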